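import Mathlib.Analysis.SpecialFunctions.Log.Basic
import Mathlib.Analysis.SpecialFunctions.Pow.Real
import Literature.IUT.HodgeArakelov.ConstantMonoidRealification
import Literature.IUT.HodgeArakelov.ArchRealifiedConstantMonoids
import Literature.AlgebraicGeometry.Frobenioids.MonoidTransport
import Literature.AnabelianGeometry.AbsoluteAnabelian.MLFGaloisPairs
import Literature.AnabelianGeometry.AbsoluteAnabelian.MLFClosureUnitsInfinitelyDivisible
import Literature.NumberTheory.GaloisRepresentations.LocalFieldFiniteExtensionIntegers
import Literature.NumberTheory.GaloisRepresentations.InertiaRootsOfUnity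
import Literature.IUT.LogThetaLattice.ThetaMonoidsKummerLabeledUnits
import Literature.AnabelianGeometry.AbsoluteAnabelian.MLFGaloisPairsWitness
import HarnessLib

/-!
# [IUTchII] Prop 4.1 (ii) at the GENUINE constant monoid `Ψ_cns(G_v) = 𝒪^▷_{F̄_v}`: `Ψ_cns/Ψ_cns^× ≅ ℚ_{≥0}`,
# its realification `≅ ℝ_{≥0}`, and the natural isomorphism `Ψ^R_cns(G_v) ⥲ R_{≥0}(G_v)` — unconditionally

S. Mochizuki, *Inter-universal Teichmüller theory II*, §4, kurims manuscript (Dec. 2020), Proposition 4.1 (ii)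
p. 121 (`v ∈ V^good ∩ V^non`), read on the page (lit key `paper:url-5036b4059555`, p. 121): "a topological monoid
`R_{≥0}(G_v)` equipped with a natural isomorphism `Ψ^R_cns(G_v) := (Ψ_cns(G_v)/Ψ_cns(G_v)^×)^rlf ⥲ R_{≥0}(G_v)` — where
the superscript '`×`' denotes the submonoid of units; the superscript '`rlf`' denotes the realification [which is
isomorphic to `ℝ_{≥0}`] of the monoid in parentheses [which is isomorphic to `ℚ_{≥0}`] — and a distinguished element
`log^{G_v}(p_v) ∈ R_{≥0}(G_v)`", with (Prop 4.1 (i) p. 120) `Ψ_cns(G_v)` "[naturally isomorphic to `𝒪^▷_{F̄_v}`]"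
[cite: Mochizuki2012, Prop 4.1 (ii) p.121]. Claim key DISPUTED (D-0012); what is proved here is classical valuation
theory of the algebraic closure of a `p`-adic field, and nothing here bears on [IUTchIII] Cor. 3.12 or takes a side.

WHAT IS IN THE TREE. abc-iut-L6-t2's `ConstantMonoidRealification.lean` types `Ψ^R := (Ψ/Ψ^×)^rlf = PsiRlf Ψ` for an
ABSTRACT commutative monoid `Ψ` and PROVES the natural-isomorphism clause (`PsiRlf.existsUnique_iso`) under the
HYPOTHESIS `h : IsMonoprime (Associates Ψ)` ("[which is isomorphic to `ℚ_{≥0}`]" — or to `ℤ_{≥0}`/`ℝ_{≥0}` — taken BY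
NAME); the same hypothesis is carried by name in `GoodPrimeKummerBridgeSemiSimplified.lean` (this lineage, Prop 4.2
(ii)) and `ThetaMonoidsKummerLabeledUnits.lean`. The GENUINE constant monoid is abc-iut-L4-t2's model `TM`-monoid
`nonzeroIntegers k K = 𝒪^▷_k̄` of an MLF `k` with algebraic closure `K = k̄` ([AbsTopIII] Def 3.1 (i), `MLFGaloisModel.lean`,
`MLFClosure`), over the integral closure `integersClosure k K = 𝒪_k̄` of `𝒪_k`.

WHAT THIS FILE PROVES (proof-only: theorems, no definitions), for every MLF `k` and every algebraic extension `K`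
(resp. algebraic closure) — tools: Mathlib's spectral norm `|·|_sp` on `K` for the valuation norm of `k` (the unique
absolute value of `k̄` extending that of `k`, Bosch–Güntzer–Remmert 3.2 / Neukirch II (4.8)), the tree's
`isIntegral_integer_iff_spectralNorm_le_one` (`LocalFieldFiniteExtensionIntegers.lean`) and the uniformiser API of
`InertiaRootsOfUnity.lean`:
* `𝒪_k̄ = {|x|_sp ≤ 1}`, `𝒪_k̄^× = {|x|_sp = 1}`; in `𝒪^▷_k̄` divisibility is the order of absolute values
  (`nonzeroIntegers_dvd_iff_spectralNorm_le`), hence TOTAL (`nonzeroIntegers_dvd_total`), units are `{|x|_sp = 1}`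
  and association is equality of absolute values;
* the value group is `ℚ`-ranked: `|x|_sp ^ n = ‖ϖ‖ ^ m` for some `n ≥ 1`, `m ∈ ℤ` (`ϖ` a uniformiser of `k`; via Mathlib
  `spectralNorm_eq_norm_coeff_zero_rpow`, `|x|_sp = ‖N(x)‖^{1/n}`), and every exponent `m/n ≥ 0` occurs in `𝒪^▷_k̄`
  (roots of `X^n - ϖ^m` in the algebraically closed `K`);
* **`isQMonoprime_associates_nonzeroIntegers`: `𝒪^▷_k̄/𝒪_k̄^× ≅ ℚ_{≥0}`** — the printed bracket "[which is isomorphic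
  to `ℚ_{≥0}`]" at `Ψ_cns(G_v) = 𝒪^▷_{F̄_v}` — hence `IsMonoprime`, and the realification bracket "[which is isomorphic
  to `ℝ_{≥0}`]" (`isRMonoprime_psiRlf_nonzeroIntegers`, via [FrdI] §0 `isRMonoprime_realification`);
* transport to EVERY MLF-Galois `TM`-pair `Q = (Π ↷ M)` ([AbsTopIII] Def 3.1 (ii); in particular every pair "of
  mono-analytic type"): `IsMonoprime (Associates Q.M)` (`isMonoprime_associates_of_isMLFGaloisMonoidPair`) — so the
  hypothesis `h` of the three files above is DISCHARGED for such pairs;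
* `p_v`-type elements (images of uniformisers of `k`, or any non-zero non-unit of `𝒪_k`) are non-units of `𝒪^▷_k̄`, and
  the natural isomorphism `Ψ^R_cns(G_v) ⥲ R_{≥0}(G_v)` of Prop 4.1 (ii) — abc-iut-L6-t2's normalised `∃!` — holds at the
  genuine constant monoid WITHOUT the monoprimality hypothesis (`existsUnique_realifiedIso_nonzeroIntegers`).

HONEST FRAMING. OUR kernel check of classical facts (Serre, *Local Fields* II §2; Neukirch, *ANT* II (4.8), (6.2));
typed ≠ discharged elsewhere; nothing asserts abc proved or refuted.
-/

noncomputable section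

open scoped NNReal NNRat

namespace Literature.IUT.HodgeArakelov

open Literature.AnabelianGeometry.AbsoluteAnabelian
open Literature.AlgebraicGeometry.Frobenioids
open Literature.NumberTheory.GaloisRepresentations
open _root_.ValuativeRel

universe u

/-! ### 1. `𝒪_k̄`, `𝒪_k̄^×`, `𝒪^▷_k̄` through the absolute value of `k̄` -/

section SpectralNorm

variable (k : Type u) [Field k] [ValuativeRel k] [TopologicalSpace k] [IsNonarchimedeanLocalField k]
  (K : Type u) [Field K] [Algebra k K] [Algebra.IsAlgebraic k K]

/-- `𝒪_k̄` is the closed unit ball of the absolute value of `k̄`: `x ∈ 𝒪_k̄ ↔ |x|_sp ≤ 1` (the tree's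
`isIntegral_integer_iff_spectralNorm_le_one` for the valuation norm of `k`).
Ref: Serre, *Local Fields*, Ch. II §2, Prop. 3. [cite: SerreLocalFields1979, Ch. II §2 Prop. 3] -/
theorem mem_integersClosure_iff_spectralNorm_le_one (x : K) :
    letI := IsNonarchimedeanLocalField.nontriviallyNormedField k
    x ∈ integersClosure k K ↔ spectralNorm k K x ≤ 1 := by
  letI := IsNonarchimedeanLocalField.nontriviallyNormedField k
  rw [mem_integersClosure_iff_isIntegral]
  exact isIntegral_integer_iff_spectralNorm_le_one (w := valuation k) (L := K)
    (IsNonarchimedeanLocalField.valuation_le_one_iff_norm_le_one (F := k))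
    (Algebra.IsAlgebraic.isAlgebraic x).isIntegral

/-- The absolute value of `k̄` is multiplicative (Mathlib `spectralAlgNorm_mul`, `k` complete).
Ref: Neukirch, *ANT*, Ch. II (4.8). [cite: NeukirchANT1999, Ch. II (4.8)] -/
theorem spectralNorm_mul_eq (x y : K) :
    letI := IsNonarchimedeanLocalField.nontriviallyNormedField k
    spectralNorm k K (x * y) = spectralNorm k K x * spectralNorm k K y := by
  letI := IsNonarchimedeanLocalField.nontriviallyNormedField k
  haveI : CompleteSpace k := IsNonarchimedeanLocalField.completeSpace_nontriviallyNormedField k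
  haveI : IsUltrametricDist k := IsNonarchimedeanLocalField.isUltrametricDist_nontriviallyNormedField k
  exact spectralAlgNorm_mul x y

/-- `|x|_sp = 0 ↔ x = 0` (the extended absolute value is an absolute value).
Ref: Neukirch, *ANT*, Ch. II (4.8). [cite: NeukirchANT1999, Ch. II (4.8)] -/
theorem spectralNorm_eq_zero_iff' (x : K) :
    letI := IsNonarchimedeanLocalField.nontriviallyNormedField k
    spectralNorm k K x = 0 ↔ x = 0 := by
  letI := IsNonarchimedeanLocalField.nontriviallyNormedField k
  refine ⟨fun h => eq_zero_of_map_spectralNorm_eq_zero h (Algebra.IsAlgebraic.isAlgebraic x), ?_⟩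
  rintro rfl
  exact spectralNorm_zero

/-- `0 < |x|_sp ↔ x ≠ 0`. Ref: Neukirch, *ANT*, Ch. II (4.8). [cite: NeukirchANT1999, Ch. II (4.8)] -/
theorem spectralNorm_pos_iff (x : K) :
    letI := IsNonarchimedeanLocalField.nontriviallyNormedField k
    0 < spectralNorm k K x ↔ x ≠ 0 := by
  letI := IsNonarchimedeanLocalField.nontriviallyNormedField k
  refine ⟨fun h h0 => ?_, fun h => spectralNorm_zero_lt h (Algebra.IsAlgebraic.isAlgebraic x)⟩
  rw [(spectralNorm_eq_zero_iff' k K x).mpr h0] at h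
  exact lt_irrefl _ h

/-- `|x ^ n|_sp = |x|_sp ^ n`. Ref: Neukirch, *ANT*, Ch. II (4.8). [cite: NeukirchANT1999, Ch. II (4.8)] -/
theorem spectralNorm_pow_eq (x : K) (n : ℕ) :
    letI := IsNonarchimedeanLocalField.nontriviallyNormedField k
    spectralNorm k K (x ^ n) = spectralNorm k K x ^ n := by
  letI := IsNonarchimedeanLocalField.nontriviallyNormedField k
  induction n with
  | zero => rw [pow_zero, pow_zero]; exact spectralNorm_one
  | succ n ih => rw [pow_succ, spectralNorm_mul_eq, ih, pow_succ]

/-- `|x⁻¹|_sp = |x|_sp⁻¹`. Ref: Neukirch, *ANT*, Ch. II (4.8). [cite: NeukirchANT1999, Ch. II (4.8)] -/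
theorem spectralNorm_inv_eq (x : K) :
    letI := IsNonarchimedeanLocalField.nontriviallyNormedField k
    spectralNorm k K x⁻¹ = (spectralNorm k K x)⁻¹ := by
  letI := IsNonarchimedeanLocalField.nontriviallyNormedField k
  by_cases hx : x = 0
  · subst hx
    rw [inv_zero, spectralNorm_zero, inv_zero]
  · have h : spectralNorm k K x * spectralNorm k K x⁻¹ = 1 := by
      rw [← spectralNorm_mul_eq, mul_inv_cancel₀ hx]
      exact spectralNorm_one
    exact eq_inv_of_mul_eq_one_right h

/-- `|x / y|_sp = |x|_sp / |y|_sp`. Ref: Neukirch, *ANT*, Ch. II (4.8). [cite: NeukirchANT1999, Ch. II (4.8)] -/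
theorem spectralNorm_div_eq (x y : K) :
    letI := IsNonarchimedeanLocalField.nontriviallyNormedField k
    spectralNorm k K (x / y) = spectralNorm k K x / spectralNorm k K y := by
  rw [div_eq_mul_inv, spectralNorm_mul_eq, spectralNorm_inv_eq, div_eq_mul_inv]

/-- `𝒪_k̄^×` is the unit sphere: `x ∈ 𝒪_k̄^× ↔ |x|_sp = 1` (both `x` and `x⁻¹` integral).
Ref: Serre, *Local Fields*, Ch. II §2, Prop. 3. [cite: SerreLocalFields1979, Ch. II §2 Prop. 3] -/
theorem mem_unitSubmonoid_iff_spectralNorm_eq_one (x : K) :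
    letI := IsNonarchimedeanLocalField.nontriviallyNormedField k
    x ∈ unitSubmonoid k K ↔ spectralNorm k K x = 1 := by
  letI := IsNonarchimedeanLocalField.nontriviallyNormedField k
  rw [mem_unitSubmonoid_iff k K, ← mem_integersClosure_iff_isIntegral k K,
    ← mem_integersClosure_iff_isIntegral k K, mem_integersClosure_iff_spectralNorm_le_one,
    mem_integersClosure_iff_spectralNorm_le_one, spectralNorm_inv_eq]
  constructor
  · rintro ⟨hx0, h1, h2⟩
    have hpos : 0 < spectralNorm k K x := (spectralNorm_pos_iff k K x).mpr hx0
    exact le_antisymm h1 ((inv_le_one₀ hpos).mp h2)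
  · intro h
    have hx0 : x ≠ 0 := by
      intro h0
      rw [(spectralNorm_eq_zero_iff' k K x).mpr h0] at h
      exact zero_ne_one h
    refine ⟨hx0, h.le, ?_⟩
    rw [h, inv_one]

omit [TopologicalSpace k] [IsNonarchimedeanLocalField k] [Algebra.IsAlgebraic k K] in
/-- Unfolding: `x ∈ 𝒪^▷_k̄ ↔ x ∈ 𝒪_k̄ ∧ x ≠ 0`. [cite: MochizukiAbsTopIII2015, Definition 3.1 (i) p.66] -/
theorem mem_nonzeroIntegers_iff (x : K) : x ∈ nonzeroIntegers k K ↔ x ∈ integersClosure k K ∧ x ≠ 0 :=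
  Iff.rfl

/-- `𝒪^▷_k̄ = {0 < |x|_sp ≤ 1}`: `x ∈ 𝒪^▷_k̄ ↔ x ≠ 0 ∧ |x|_sp ≤ 1`.
Ref: Serre, *Local Fields*, Ch. II §2, Prop. 3. [cite: SerreLocalFields1979, Ch. II §2 Prop. 3] -/
theorem mem_nonzeroIntegers_iff_spectralNorm (x : K) :
    letI := IsNonarchimedeanLocalField.nontriviallyNormedField k
    x ∈ nonzeroIntegers k K ↔ x ≠ 0 ∧ spectralNorm k K x ≤ 1 := by
  rw [mem_nonzeroIntegers_iff, mem_integersClosure_iff_spectralNorm_le_one, and_comm]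

end SpectralNorm

/-! ### 2. The divisor monoid of `𝒪^▷_k̄`: divisibility is the order of absolute values, units the unit sphere -/

section DivisorMonoid

variable (k : Type u) [Field k] [ValuativeRel k] [TopologicalSpace k] [IsNonarchimedeanLocalField k]
  (K : Type u) [Field K] [Algebra k K] [Algebra.IsAlgebraic k K]

omit [TopologicalSpace k] [IsNonarchimedeanLocalField k] [Algebra.IsAlgebraic k K] in
/-- Elements of `𝒪^▷_k̄` are non-zero. [cite: MochizukiAbsTopIII2015, Definition 3.1 (i) p.66] -/
theorem coe_nonzeroIntegers_ne_zero (a : nonzeroIntegers k K) : (a : K) ≠ 0 := a.2.2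

/-- Elements of `𝒪^▷_k̄` have absolute value in `(0, 1]`: positivity.
Ref: Serre, *Local Fields*, Ch. II §2, Prop. 3. [cite: SerreLocalFields1979, Ch. II §2 Prop. 3] -/
theorem spectralNorm_coe_nonzeroIntegers_pos (a : nonzeroIntegers k K) :
    letI := IsNonarchimedeanLocalField.nontriviallyNormedField k
    0 < spectralNorm k K (a : K) :=
  (spectralNorm_pos_iff k K _).mpr (coe_nonzeroIntegers_ne_zero k K a)

/-- Elements of `𝒪^▷_k̄` have absolute value in `(0, 1]`: the bound.
Ref: Serre, *Local Fields*, Ch. II §2, Prop. 3. [cite: SerreLocalFields1979, Ch. II §2 Prop. 3] -/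
theorem spectralNorm_coe_nonzeroIntegers_le_one (a : nonzeroIntegers k K) :
    letI := IsNonarchimedeanLocalField.nontriviallyNormedField k
    spectralNorm k K (a : K) ≤ 1 :=
  ((mem_nonzeroIntegers_iff_spectralNorm k K _).mp a.2).2

/-- **Divisibility in `𝒪^▷_k̄` is the order of absolute values**: `a ∣ b ↔ |b| ≤ |a|` (`⇐`: `b/a` has absolute
value `≤ 1`, hence is a non-zero integer).
Ref: Neukirch, *ANT*, Ch. II (4.8), (6.2). [cite: NeukirchANT1999, Ch. II (4.8)] -/
theorem nonzeroIntegers_dvd_iff_spectralNorm_le (a b : nonzeroIntegers k K) :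
    letI := IsNonarchimedeanLocalField.nontriviallyNormedField k
    a ∣ b ↔ spectralNorm k K (b : K) ≤ spectralNorm k K (a : K) := by
  letI := IsNonarchimedeanLocalField.nontriviallyNormedField k
  constructor
  · rintro ⟨c, hc⟩
    rw [hc, Submonoid.coe_mul, spectralNorm_mul_eq]
    exact mul_le_of_le_one_right (spectralNorm_nonneg _) (spectralNorm_coe_nonzeroIntegers_le_one k K c)
  · intro h
    have ha0 : (a : K) ≠ 0 := coe_nonzeroIntegers_ne_zero k K a
    have hb0 : (b : K) ≠ 0 := coe_nonzeroIntegers_ne_zero k K b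
    have hapos : 0 < spectralNorm k K (a : K) := spectralNorm_coe_nonzeroIntegers_pos k K a
    have hc : (b : K) / a ∈ nonzeroIntegers k K := by
      rw [mem_nonzeroIntegers_iff_spectralNorm]
      refine ⟨div_ne_zero hb0 ha0, ?_⟩
      rw [spectralNorm_div_eq]
      exact (div_le_one hapos).mpr h
    refine ⟨⟨(b : K) / a, hc⟩, Subtype.ext ?_⟩
    change (b : K) = a * ((b : K) / a)
    rw [mul_div_assoc', mul_div_cancel_left₀ _ ha0]

/-- **Divisibility in `𝒪^▷_k̄` is TOTAL** (`𝒪^▷_k̄/𝒪_k̄^×` is totally ordered — a valuation monoid).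
Ref: Neukirch, *ANT*, Ch. II (4.8). [cite: NeukirchANT1999, Ch. II (4.8)] -/
theorem nonzeroIntegers_dvd_total (a b : nonzeroIntegers k K) : a ∣ b ∨ b ∣ a := by
  letI := IsNonarchimedeanLocalField.nontriviallyNormedField k
  rcases le_total (spectralNorm k K (b : K)) (spectralNorm k K (a : K)) with h | h
  · exact Or.inl ((nonzeroIntegers_dvd_iff_spectralNorm_le k K a b).mpr h)
  · exact Or.inr ((nonzeroIntegers_dvd_iff_spectralNorm_le k K b a).mpr h)

/-- **The units of `𝒪^▷_k̄` are the elements of absolute value `1`** (i.e. `(𝒪^▷_k̄)^× = 𝒪_k̄^×`).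
Ref: Serre, *Local Fields*, Ch. II §2, Prop. 3. [cite: SerreLocalFields1979, Ch. II §2 Prop. 3] -/
theorem nonzeroIntegers_isUnit_iff_spectralNorm_eq_one (a : nonzeroIntegers k K) :
    letI := IsNonarchimedeanLocalField.nontriviallyNormedField k
    IsUnit a ↔ spectralNorm k K (a : K) = 1 := by
  letI := IsNonarchimedeanLocalField.nontriviallyNormedField k
  constructor
  · rintro ⟨u, rfl⟩
    have h1 : spectralNorm k K ((u : nonzeroIntegers k K) : K) *
        spectralNorm k K ((u⁻¹ : (nonzeroIntegers k K)ˣ) : nonzeroIntegers k K) = 1 := by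
      rw [← spectralNorm_mul_eq, ← Submonoid.coe_mul, Units.mul_inv, Submonoid.coe_one]
      exact spectralNorm_one
    have hu1 := spectralNorm_coe_nonzeroIntegers_le_one k K (u : nonzeroIntegers k K)
    have hv1 := spectralNorm_coe_nonzeroIntegers_le_one k K
      ((u⁻¹ : (nonzeroIntegers k K)ˣ) : nonzeroIntegers k K)
    by_contra hne
    exact (mul_lt_one_of_nonneg_of_lt_one_left (spectralNorm_nonneg _) (lt_of_le_of_ne hu1 hne) hv1).ne h1
  · intro h
    have hmem : ((a : nonzeroIntegers k K) : K) ∈ unitSubmonoid k K :=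
      (mem_unitSubmonoid_iff_spectralNorm_eq_one k K _).mpr h
    obtain ⟨-, y, hy, hay⟩ := hmem
    have hy0 : y ≠ 0 := by
      rintro rfl
      rw [mul_zero] at hay
      exact zero_ne_one hay
    exact isUnit_iff_exists_inv.mpr ⟨⟨y, hy, hy0⟩, Subtype.ext hay⟩

/-- An element of `𝒪^▷_k̄` of absolute value `< 1` is NOT a unit.
Ref: Serre, *Local Fields*, Ch. II §2, Prop. 3. [cite: SerreLocalFields1979, Ch. II §2 Prop. 3] -/
theorem nonzeroIntegers_not_isUnit_of_spectralNorm_lt_one (a : nonzeroIntegers k K)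
    (h : letI := IsNonarchimedeanLocalField.nontriviallyNormedField k; spectralNorm k K (a : K) < 1) :
    ¬ IsUnit a := fun hu =>
  h.ne ((nonzeroIntegers_isUnit_iff_spectralNorm_eq_one k K a).mp hu)

/-- **Association in `𝒪^▷_k̄` is equality of absolute values**: `a ~ᵤ b ↔ |a| = |b|`.
Ref: Neukirch, *ANT*, Ch. II (4.8). [cite: NeukirchANT1999, Ch. II (4.8)] -/
theorem nonzeroIntegers_associated_iff_spectralNorm_eq (a b : nonzeroIntegers k K) :
    letI := IsNonarchimedeanLocalField.nontriviallyNormedField k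
    Associated a b ↔ spectralNorm k K (a : K) = spectralNorm k K (b : K) := by
  letI := IsNonarchimedeanLocalField.nontriviallyNormedField k
  constructor
  · rintro ⟨u, rfl⟩
    rw [Submonoid.coe_mul, spectralNorm_mul_eq,
      (nonzeroIntegers_isUnit_iff_spectralNorm_eq_one k K _).mp u.isUnit, mul_one]
  · intro h
    have hapos : 0 < spectralNorm k K (a : K) := spectralNorm_coe_nonzeroIntegers_pos k K a
    obtain ⟨c, hc⟩ := (nonzeroIntegers_dvd_iff_spectralNorm_le k K a b).mpr h.symm.le
    have hc1 : spectralNorm k K (c : K) = 1 := by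
      have h2 : spectralNorm k K (b : K) = spectralNorm k K (a : K) * spectralNorm k K (c : K) := by
        rw [hc, Submonoid.coe_mul, spectralNorm_mul_eq]
      rw [← h] at h2
      have h3 : spectralNorm k K (a : K) * spectralNorm k K (c : K) = spectralNorm k K (a : K) * 1 := by
        rw [mul_one]; exact h2.symm
      exact mul_left_cancel₀ hapos.ne' h3
    obtain ⟨u, hu⟩ := (nonzeroIntegers_isUnit_iff_spectralNorm_eq_one k K c).mpr hc1
    exact ⟨u, by rw [hu, hc]⟩

end DivisorMonoid

/-! ### 3. The value group: `ℚ`-ranked over the uniformiser of `k`, and every non-negative exponent occurs -/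

section BaseField

variable (k : Type u) [Field k] [ValuativeRel k] [TopologicalSpace k] [IsNonarchimedeanLocalField k]

/-- A uniformiser `ϖ` of `k` has `0 < ‖ϖ‖` (valuation norm).
Ref: Serre, *Local Fields*, Ch. I §1. [cite: SerreLocalFields1979, Ch. I §1] -/
theorem norm_uniformizer_pos {ϖ : 𝒪[k]} (hϖ : Irreducible ϖ) :
    letI := IsNonarchimedeanLocalField.nontriviallyNormedField k
    0 < ‖(ϖ : k)‖ := by
  letI := IsNonarchimedeanLocalField.nontriviallyNormedField k
  have h := IsNonarchimedeanLocalField.algNorm_uniformizer_pos hϖ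
  rwa [IsScalarTower.algebraMap_apply 𝒪[k] k (AlgebraicClosure k),
    IsNonarchimedeanLocalField.algNorm_algebraMap] at h

/-- A uniformiser `ϖ` of `k` has `‖ϖ‖ < 1` (valuation norm).
Ref: Serre, *Local Fields*, Ch. I §1. [cite: SerreLocalFields1979, Ch. I §1] -/
theorem norm_uniformizer_lt_one {ϖ : 𝒪[k]} (hϖ : Irreducible ϖ) :
    letI := IsNonarchimedeanLocalField.nontriviallyNormedField k
    ‖(ϖ : k)‖ < 1 := by
  letI := IsNonarchimedeanLocalField.nontriviallyNormedField k
  have h := IsNonarchimedeanLocalField.algNorm_uniformizer_lt_one hϖ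
  rwa [IsScalarTower.algebraMap_apply 𝒪[k] k (AlgebraicClosure k),
    IsNonarchimedeanLocalField.algNorm_algebraMap] at h

/-- **The value group of `k` is generated by `‖ϖ‖`**: every `c ≠ 0` has `‖c‖ = ‖ϖ‖ ^ m` for some `m ∈ ℤ` (the
tree's `exists_algNorm_algebraMap_eq_zpow` read back in `k`).
Ref: Serre, *Local Fields*, Ch. I §1; Neukirch, *ANT*, Ch. II (3.8). [cite: SerreLocalFields1979, Ch. II §2 Prop. 3] -/
theorem exists_norm_eq_norm_uniformizer_zpow {ϖ : 𝒪[k]} (hϖ : Irreducible ϖ) {c : k} (hc : c ≠ 0) :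
    letI := IsNonarchimedeanLocalField.nontriviallyNormedField k
    ∃ m : ℤ, ‖c‖ = ‖(ϖ : k)‖ ^ m := by
  letI := IsNonarchimedeanLocalField.nontriviallyNormedField k
  obtain ⟨m, hm⟩ := IsNonarchimedeanLocalField.exists_algNorm_algebraMap_eq_zpow hϖ hc
  refine ⟨m, ?_⟩
  rwa [IsNonarchimedeanLocalField.algNorm_algebraMap,
    IsScalarTower.algebraMap_apply 𝒪[k] k (AlgebraicClosure k),
    IsNonarchimedeanLocalField.algNorm_algebraMap] at hm

end BaseField

section ValueGroup

variable (k : Type u) [Field k] [ValuativeRel k] [TopologicalSpace k] [IsNonarchimedeanLocalField k]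
  (K : Type u) [Field K] [Algebra k K] [Algebra.IsAlgebraic k K]

omit [Algebra.IsAlgebraic k K] in
/-- The absolute value of `k̄` restricts to the valuation norm of `k` (Mathlib `spectralNorm_extends`).
Ref: Neukirch, *ANT*, Ch. II (4.8). [cite: NeukirchANT1999, Ch. II (4.8)] -/
theorem spectralNorm_algebraMap_eq_norm (c : k) :
    letI := IsNonarchimedeanLocalField.nontriviallyNormedField k
    spectralNorm k K (algebraMap k K c) = ‖c‖ := by
  letI := IsNonarchimedeanLocalField.nontriviallyNormedField k
  exact spectralNorm_extends c

/-- **The value group of `k̄` is `ℚ`-ranked over `‖ϖ‖`**: for `x ∈ k̄`, `x ≠ 0`, there are `n ≥ 1` and `m ∈ ℤ` with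
`|x|_sp ^ n = ‖ϖ‖ ^ m` — from `|x|_sp = ‖N(x)‖^{1/n}`, `n = [k(x):k]`, `N(x) = ±` the constant coefficient of the
minimal polynomial (Mathlib `spectralNorm_eq_norm_coeff_zero_rpow`), and `‖N(x)‖ ∈ ‖ϖ‖^ℤ`.
Ref: Neukirch, *ANT*, Ch. II (4.8) ("`|x| = |N_{L|K}(x)|^{1/n}`"). [cite: NeukirchANT1999, Ch. II (4.8)] -/
theorem exists_spectralNorm_pow_eq_norm_uniformizer_zpow {ϖ : 𝒪[k]} (hϖ : Irreducible ϖ) {x : K} (hx : x ≠ 0) :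
    letI := IsNonarchimedeanLocalField.nontriviallyNormedField k
    ∃ n : ℕ, 0 < n ∧ ∃ m : ℤ, spectralNorm k K x ^ n = ‖(ϖ : k)‖ ^ m := by
  letI := IsNonarchimedeanLocalField.nontriviallyNormedField k
  haveI : CompleteSpace k := IsNonarchimedeanLocalField.completeSpace_nontriviallyNormedField k
  haveI : IsUltrametricDist k := IsNonarchimedeanLocalField.isUltrametricDist_nontriviallyNormedField k
  have hxi : IsIntegral k x := (Algebra.IsAlgebraic.isAlgebraic x).isIntegral
  have hn0 : 0 < (minpoly k x).natDegree := minpoly.natDegree_pos hxi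
  have hc0 : (minpoly k x).coeff 0 ≠ 0 := minpoly.coeff_zero_ne_zero hxi hx
  obtain ⟨m, hm⟩ := exists_norm_eq_norm_uniformizer_zpow k hϖ hc0
  refine ⟨(minpoly k x).natDegree, hn0, m, ?_⟩
  have hnR : ((minpoly k x).natDegree : ℝ) ≠ 0 := Nat.cast_ne_zero.mpr hn0.ne'
  rw [← hm, spectralNorm.spectralNorm_eq_norm_coeff_zero_rpow k K x, ← Real.rpow_natCast,
    ← Real.rpow_mul (norm_nonneg _), one_div_mul_cancel hnR, Real.rpow_one]

/-- The image of a uniformiser of `k` lies in `𝒪^▷_k̄`. [cite: MochizukiAbsTopIII2015, Definition 3.1 (i) p.66] -/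
theorem algebraMap_uniformizer_mem_nonzeroIntegers {ϖ : 𝒪[k]} (hϖ : Irreducible ϖ) :
    algebraMap k K (ϖ : k) ∈ nonzeroIntegers k K := by
  letI := IsNonarchimedeanLocalField.nontriviallyNormedField k
  rw [mem_nonzeroIntegers_iff_spectralNorm, spectralNorm_algebraMap_eq_norm]
  refine ⟨?_, (norm_uniformizer_lt_one k hϖ).le⟩
  rw [map_ne_zero]
  exact fun h => hϖ.ne_zero (Subtype.ext h)

/-- **The image of a uniformiser of `k` is NOT a unit of `𝒪^▷_k̄`** (its absolute value is `< 1`) — a `p_v`-type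
non-unit as required by "the distinguished element `log(p_v)`" of [IUTchII] Prop 4.1 (ii).
[cite: Mochizuki2012, Prop 4.1 (ii) p.121] -/
theorem not_isUnit_algebraMap_uniformizer {ϖ : 𝒪[k]} (hϖ : Irreducible ϖ) :
    ¬ IsUnit (⟨algebraMap k K (ϖ : k), algebraMap_uniformizer_mem_nonzeroIntegers k K hϖ⟩ :
      nonzeroIntegers k K) := by
  letI := IsNonarchimedeanLocalField.nontriviallyNormedField k
  refine nonzeroIntegers_not_isUnit_of_spectralNorm_lt_one k K _ ?_
  change spectralNorm k K (algebraMap k K (ϖ : k)) < 1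
  rw [spectralNorm_algebraMap_eq_norm]
  exact norm_uniformizer_lt_one k hϖ

/-- Non-zero elements of `𝒪_k` map into `𝒪^▷_k̄`. [cite: MochizukiAbsTopIII2015, Definition 3.1 (i) p.66] -/
theorem algebraMap_mem_nonzeroIntegers {c : k} (hc : c ∈ 𝒪[k]) (hc0 : c ≠ 0) :
    algebraMap k K c ∈ nonzeroIntegers k K := by
  letI := IsNonarchimedeanLocalField.nontriviallyNormedField k
  rw [mem_nonzeroIntegers_iff_spectralNorm, spectralNorm_algebraMap_eq_norm,
    IsNonarchimedeanLocalField.norm_le_one_iff k c]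
  exact ⟨(map_ne_zero _).mpr hc0, hc⟩

/-- **A non-zero element of `𝓂_k` (valuation `< 1`) maps to a NON-UNIT of `𝒪^▷_k̄`.**
Ref: Serre, *Local Fields*, Ch. II §2, Prop. 3. [cite: SerreLocalFields1979, Ch. II §2 Prop. 3] -/
theorem not_isUnit_algebraMap_of_valuation_lt_one {c : k} (hc0 : c ≠ 0) (hc1 : valuation k c < 1) :
    ¬ IsUnit (⟨algebraMap k K c, algebraMap_mem_nonzeroIntegers k K
        ((Valuation.mem_integer_iff _ _).mpr hc1.le) hc0⟩ : nonzeroIntegers k K) := by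
  letI := IsNonarchimedeanLocalField.nontriviallyNormedField k
  refine nonzeroIntegers_not_isUnit_of_spectralNorm_lt_one k K _ ?_
  change spectralNorm k K (algebraMap k K c) < 1
  rw [spectralNorm_algebraMap_eq_norm, IsNonarchimedeanLocalField.norm_lt_one_iff k c]
  exact hc1

/-- The residue characteristic `p_v` of `k` is non-zero in `k` (characteristic `0`; the "unequal characteristic"
case). Ref: Serre, *Local Fields*, Ch. II §5. [cite: SerreLocalFields1979, Ch. II §5] -/
theorem natCast_ringChar_residueField_ne_zero [CharZero k] : ((ringChar 𝓀[k] : ℕ) : k) ≠ 0 :=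
  Nat.cast_ne_zero.mpr (CharP.ringChar_ne_zero_of_finite 𝓀[k])

/-- The residue characteristic `p_v` of `k` lies in `𝓂_k`: `v(p_v) < 1` (the absolute ramification index
`e = v(p) ≥ 1`). Ref: Serre, *Local Fields*, Ch. II §5. [cite: SerreLocalFields1979, Ch. II §5] -/
theorem valuation_natCast_ringChar_residueField_lt_one : valuation k ((ringChar 𝓀[k] : ℕ) : k) < 1 := by
  have h : ((ringChar 𝓀[k] : ℕ) : 𝒪[k]) ∈ 𝓂[k] := by
    rw [← IsLocalRing.residue_eq_zero_iff, map_natCast]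
    exact ringChar.Nat.cast_ringChar
  rw [IsLocalRing.mem_maximalIdeal, mem_nonunits_iff, Valuation.Integer.not_isUnit_iff_valuation_lt_one] at h
  exact_mod_cast h

/-- `p_v ∈ 𝒪^▷_k̄` (the residue characteristic of `k`, `k` of characteristic `0`).
[cite: Mochizuki2012, Prop 4.1 (ii) p.121] -/
theorem natCast_ringChar_residueField_mem_nonzeroIntegers [CharZero k] :
    ((ringChar 𝓀[k] : ℕ) : K) ∈ nonzeroIntegers k K := by
  have h := algebraMap_mem_nonzeroIntegers k K (c := ((ringChar 𝓀[k] : ℕ) : k))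
    ((Valuation.mem_integer_iff _ _).mpr (valuation_natCast_ringChar_residueField_lt_one k).le)
    (natCast_ringChar_residueField_ne_zero k)
  rwa [map_natCast] at h

/-- **`p_v` is NOT a unit of `𝒪^▷_k̄ = Ψ_cns(G_v)`** — the element behind "the distinguished element `log^{G_v}(p_v)`"
of [IUTchII] Prop 4.1 (ii). [cite: Mochizuki2012, Prop 4.1 (ii) p.121] -/
theorem not_isUnit_natCast_ringChar_residueField [CharZero k]
    (h : ((ringChar 𝓀[k] : ℕ) : K) ∈ nonzeroIntegers k K) : ¬ IsUnit (⟨_, h⟩ : nonzeroIntegers k K) := by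
  have h' := not_isUnit_algebraMap_of_valuation_lt_one k K (c := ((ringChar 𝓀[k] : ℕ) : k))
    (natCast_ringChar_residueField_ne_zero k) (valuation_natCast_ringChar_residueField_lt_one k)
  have e : (⟨_, h⟩ : nonzeroIntegers k K) =
      ⟨algebraMap k K ((ringChar 𝓀[k] : ℕ) : k), algebraMap_mem_nonzeroIntegers k K
        (c := ((ringChar 𝓀[k] : ℕ) : k))
        ((Valuation.mem_integer_iff _ _).mpr (valuation_natCast_ringChar_residueField_lt_one k).le)
        (natCast_ringChar_residueField_ne_zero k)⟩ :=
    Subtype.ext (map_natCast (algebraMap k K) _).symm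
  rw [e]
  exact h'

/-- **Every exponent `m/n ≥ 0` occurs** (`K` algebraically closed): there is `y ∈ 𝒪^▷_k̄` with `y ^ n = ϖ ^ m`, hence
`|y|_sp ^ n = ‖ϖ‖ ^ m` (a root of `X^n - ϖ^m`; `|y| = |N(y)|^{1/n}`).
Ref: Neukirch, *ANT*, Ch. II (4.8). [cite: NeukirchANT1999, Ch. II (4.8)] -/
theorem exists_mem_nonzeroIntegers_pow_eq_uniformizer_pow [IsAlgClosed K] {ϖ : 𝒪[k]} (hϖ : Irreducible ϖ)
    (m : ℕ) {n : ℕ} (hn : 0 < n) :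
    letI := IsNonarchimedeanLocalField.nontriviallyNormedField k
    ∃ y : nonzeroIntegers k K, spectralNorm k K (y : K) ^ n = ‖(ϖ : k)‖ ^ m := by
  letI := IsNonarchimedeanLocalField.nontriviallyNormedField k
  obtain ⟨y, hy⟩ := IsAlgClosed.exists_pow_nat_eq (algebraMap k K (ϖ : k) ^ m) hn
  have hϖK : algebraMap k K (ϖ : k) ≠ 0 :=
    coe_nonzeroIntegers_ne_zero k K ⟨_, algebraMap_uniformizer_mem_nonzeroIntegers k K hϖ⟩
  have hnorm : spectralNorm k K y ^ n = ‖(ϖ : k)‖ ^ m := by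
    rw [← spectralNorm_pow_eq, hy, spectralNorm_pow_eq, spectralNorm_algebraMap_eq_norm]
  have hy0 : y ≠ 0 := by
    rintro rfl
    rw [zero_pow hn.ne'] at hy
    exact pow_ne_zero m hϖK hy.symm
  have hy1 : spectralNorm k K y ≤ 1 := by
    rw [← pow_le_one_iff_of_nonneg (spectralNorm_nonneg _) hn.ne', hnorm]
    exact pow_le_one₀ (norm_nonneg _) (norm_uniformizer_lt_one k hϖ).le
  exact ⟨⟨y, (mem_nonzeroIntegers_iff_spectralNorm k K y).mpr ⟨hy0, hy1⟩⟩, hnorm⟩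

end ValueGroup

/-! ### 4. `𝒪^▷_k̄/𝒪_k̄^× ≅ ℚ_{≥0}` — the bracket "[which is isomorphic to `ℚ_{≥0}`]" of Prop 4.1 (ii) at the genuine
constant monoid -/

section Monoprime

/-- Descent of a monoid homomorphism constant exactly on associates to an ISOMORPHISM from the monoid of
associates: if `f x = f y ↔ x ~ᵤ y` and `f` is surjective then `Associates M ≃* N` (plumbing). [folklore] -/
private theorem nonempty_associates_mulEquiv_of_hom {M : Type u} {N : Type*} [CommMonoid M] [CommMonoid N]
    (f : M →* N) (hf : ∀ x y, f x = f y ↔ Associated x y) (hsurj : Function.Surjective f) :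
    Nonempty (Associates M ≃* N) := by
  let g : Associates M → N := Quotient.lift f fun a b h => (hf a b).mpr h
  have hg : ∀ a : M, g (Associates.mk a) = f a := fun _ => rfl
  let G : Associates M →* N :=
    { toFun := g
      map_one' := by rw [Associates.one_eq_mk_one, hg, map_one]
      map_mul' := fun x y => by
        obtain ⟨a, rfl⟩ := Associates.mk_surjective x
        obtain ⟨b, rfl⟩ := Associates.mk_surjective y
        rw [Associates.mk_mul_mk, hg, hg, hg, map_mul] }
  have hinj : Function.Injective G := by
    intro x y hxy
    obtain ⟨a, rfl⟩ := Associates.mk_surjective x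
    obtain ⟨b, rfl⟩ := Associates.mk_surjective y
    exact Associates.mk_eq_mk_iff_associated.mpr ((hf a b).mp hxy)
  have hsur : Function.Surjective G := fun n => by
    obtain ⟨a, ha⟩ := hsurj n
    exact ⟨Associates.mk a, ha⟩
  exact ⟨MulEquiv.ofBijective G ⟨hinj, hsur⟩⟩

variable (k : Type u) [Field k] [ValuativeRel k] [TopologicalSpace k] [IsNonarchimedeanLocalField k]
  (K : Type u) [Field K] [Algebra k K] [Algebra.IsAlgebraic k K]

/-- **`𝒪^▷_k̄/𝒪_k̄^× ≅ ℚ_{≥0}`** for an MLF `k` and an algebraically closed algebraic extension `K = k̄`: the monoid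
`Ψ_cns(G_v)/Ψ_cns(G_v)^×` of [IUTchII] Prop 4.1 (ii) at the genuine constant monoid `Ψ_cns(G_v) = 𝒪^▷_{F̄_v}` IS
"isomorphic to `ℚ_{≥0}`" ([FrdI] §0 `IsQMonoprime`). The isomorphism is the normalised valuation
`[x] ↦ log|x|_sp / log‖ϖ‖ = ord_ϖ(x) ∈ ℚ_{≥0}`: well defined and injective on associates by §2, `ℚ`-valued by
`exists_spectralNorm_pow_eq_norm_uniformizer_zpow`, surjective by `exists_mem_nonzeroIntegers_pow_eq_uniformizer_pow`.
[cite: Mochizuki2012, Prop 4.1 (ii) p.121] -/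
theorem isQMonoprime_associates_nonzeroIntegers [IsAlgClosed K] :
    IsQMonoprime (Associates (nonzeroIntegers k K)) := by
  letI := IsNonarchimedeanLocalField.nontriviallyNormedField k
  obtain ⟨ϖ, hϖ⟩ := IsDiscreteValuationRing.exists_irreducible 𝒪[k]
  have ha0 : 0 < ‖(ϖ : k)‖ := norm_uniformizer_pos k hϖ
  have ha1 : ‖(ϖ : k)‖ < 1 := norm_uniformizer_lt_one k hϖ
  have hL : Real.log ‖(ϖ : k)‖ < 0 := Real.log_neg ha0 ha1
  have hL0 : Real.log ‖(ϖ : k)‖ ≠ 0 := hL.ne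
  -- the normalised valuation `r x := log|x| / log‖ϖ‖` is `ℚ_{≥0}`-valued
  have key : ∀ x : nonzeroIntegers k K, ∃ q : ℚ≥0,
      ((q : ℚ) : ℝ) = Real.log (spectralNorm k K (x : K)) / Real.log ‖(ϖ : k)‖ := by
    intro x
    have hxpos : 0 < spectralNorm k K (x : K) := spectralNorm_coe_nonzeroIntegers_pos k K x
    have hx1 : spectralNorm k K (x : K) ≤ 1 := spectralNorm_coe_nonzeroIntegers_le_one k K x
    obtain ⟨n, hn, m, hnm⟩ :=
      exists_spectralNorm_pow_eq_norm_uniformizer_zpow k K hϖ (coe_nonzeroIntegers_ne_zero k K x)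
    have hnR : (n : ℝ) ≠ 0 := Nat.cast_ne_zero.mpr hn.ne'
    have hlog : (n : ℝ) * Real.log (spectralNorm k K (x : K)) = (m : ℝ) * Real.log ‖(ϖ : k)‖ := by
      rw [← Real.log_pow, ← Real.log_zpow, hnm]
    have hratio : Real.log (spectralNorm k K (x : K)) / Real.log ‖(ϖ : k)‖ = (m : ℝ) / n := by
      rw [div_eq_div_iff hL0 hnR]
      linarith [hlog]
    have hnonneg : (0 : ℝ) ≤ (m : ℝ) / n := by
      rw [← hratio]
      exact div_nonneg_of_nonpos (Real.log_nonpos hxpos.le hx1) hL.le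
    have hq : (0 : ℚ) ≤ (m : ℚ) / n := by
      have : ((((m : ℚ) / n : ℚ)) : ℝ) = (m : ℝ) / n := by push_cast; ring
      exact_mod_cast this ▸ hnonneg
    refine ⟨⟨(m : ℚ) / n, hq⟩, ?_⟩
    rw [hratio, NNRat.coe_mk]
    push_cast
    ring
  choose q hq using key
  -- equality of normalised valuations is association
  have hq_eq : ∀ x y : nonzeroIntegers k K, q x = q y ↔ Associated x y := by
    intro x y
    have hxpos : 0 < spectralNorm k K (x : K) := spectralNorm_coe_nonzeroIntegers_pos k K x
    have hypos : 0 < spectralNorm k K (y : K) := spectralNorm_coe_nonzeroIntegers_pos k K y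
    rw [nonzeroIntegers_associated_iff_spectralNorm_eq, ← Real.log_injOn_pos.eq_iff hxpos hypos,
      ← div_left_inj' hL0, ← hq x, ← hq y, Rat.cast_inj, NNRat.coe_inj]
  -- the normalised valuation is additive
  have hq_mul : ∀ x y : nonzeroIntegers k K, q (x * y) = q x + q y := by
    intro x y
    have hx0 : spectralNorm k K (x : K) ≠ 0 := (spectralNorm_coe_nonzeroIntegers_pos k K x).ne'
    have hy0 : spectralNorm k K (y : K) ≠ 0 := (spectralNorm_coe_nonzeroIntegers_pos k K y).ne'
    have h : ((q (x * y) : ℚ) : ℝ) = (((q x + q y : ℚ≥0) : ℚ) : ℝ) := by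
      rw [NNRat.coe_add, Rat.cast_add, hq, hq, hq, Submonoid.coe_mul, spectralNorm_mul_eq,
        Real.log_mul hx0 hy0, add_div]
    exact NNRat.coe_inj.mp (Rat.cast_injective h)
  -- the homomorphism `𝒪^▷_k̄ → ℚ_{≥0}` (multiplicative notation)
  let f : nonzeroIntegers k K →* Multiplicative ℚ≥0 :=
    { toFun := fun x => Multiplicative.ofAdd (q x)
      map_one' := by
        have h1 : q 1 = 0 := by
          have h := hq_mul 1 1
          rw [one_mul] at h
          simpa using h
        rw [h1, ofAdd_zero]
      map_mul' := fun x y => by rw [hq_mul, ofAdd_add] }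
  have hf : ∀ x y, f x = f y ↔ Associated x y := fun x y => by
    rw [← hq_eq]
    exact Multiplicative.ofAdd.injective.eq_iff
  -- surjectivity: every `m/n ≥ 0` is the valuation of a root of `X^n - ϖ^m`
  have hsurj : Function.Surjective f := by
    intro Q
    set q₀ : ℚ≥0 := Multiplicative.toAdd Q with hq₀
    obtain ⟨y, hy⟩ := exists_mem_nonzeroIntegers_pow_eq_uniformizer_pow k K hϖ q₀.num q₀.den_pos
    refine ⟨y, ?_⟩
    have hypos : 0 < spectralNorm k K (y : K) := spectralNorm_coe_nonzeroIntegers_pos k K y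
    have hnR : (q₀.den : ℝ) ≠ 0 := Nat.cast_ne_zero.mpr q₀.den_pos.ne'
    have hlog : (q₀.den : ℝ) * Real.log (spectralNorm k K (y : K)) = (q₀.num : ℝ) * Real.log ‖(ϖ : k)‖ := by
      rw [← Real.log_pow, ← Real.log_pow, hy]
    have hratio : Real.log (spectralNorm k K (y : K)) / Real.log ‖(ϖ : k)‖ = (q₀.num : ℝ) / q₀.den := by
      rw [div_eq_div_iff hL0 hnR]
      linarith [hlog]
    have hqy : q y = q₀ := by
      have h : ((q y : ℚ) : ℝ) = ((q₀ : ℚ) : ℝ) := by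
        rw [hq, hratio]
        conv_rhs => rw [← NNRat.num_div_den q₀]
        push_cast
        ring
      exact NNRat.coe_inj.mp (Rat.cast_injective h)
    change Multiplicative.ofAdd (q y) = Q
    rw [hqy, hq₀, ofAdd_toAdd]
  exact ⟨nonempty_associates_mulEquiv_of_hom f hf hsurj⟩

/-- Hence `𝒪^▷_k̄/𝒪_k̄^×` is MONOPRIME ([FrdI] §0) — the hypothesis `h : IsMonoprime (Associates Ψ)` of
abc-iut-L6-t2's `PsiRlf.existsUnique_iso` / `PsiRlf.toNNReal` and of `GoodPrimeKummerBridgeSemiSimplified`,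
`ThetaMonoidsKummerLabeledUnits`, DISCHARGED at `Ψ = 𝒪^▷_k̄`. [cite: Mochizuki2012, Prop 4.1 (ii) p.121] -/
theorem isMonoprime_associates_nonzeroIntegers [IsAlgClosed K] : IsMonoprime (Associates (nonzeroIntegers k K)) :=
  IsMonoprime.ofQ (isQMonoprime_associates_nonzeroIntegers k K)

/-- … and its realification `Ψ^R_cns = (𝒪^▷_k̄/𝒪_k̄^×)^rlf` is `ℝ`-monoprime — the bracket "the realification [which is
isomorphic to `ℝ_{≥0}`]" of Prop 4.1 (ii) at the genuine constant monoid ([FrdI] §0 `isRMonoprime_realification`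
through abc-iut-L6-t2's `PsiRlf.isRMonoprime`). [cite: Mochizuki2012, Prop 4.1 (ii) p.121] -/
theorem isRMonoprime_psiRlf_nonzeroIntegers [IsAlgClosed K] : IsRMonoprime (PsiRlf (nonzeroIntegers k K)) :=
  PsiRlf.isRMonoprime (isMonoprime_associates_nonzeroIntegers k K)

end Monoprime

/-! ### 5. The model data `MLFClosure`, MLF-Galois `TM`-pairs, and the natural isomorphism of Prop 4.1 (ii) -/

section Model

/-- **[IUTchII] Prop 4.1 (ii) "[which is isomorphic to `ℚ_{≥0}`]" for the model data** `C = (k, k̄)` of [AbsTopIII]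
Def 3.1 (i): `𝒪^▷_k̄/𝒪_k̄^× ≅ ℚ_{≥0}`. [cite: Mochizuki2012, Prop 4.1 (ii) p.121] -/
theorem isQMonoprime_associates_nonzeroIntegers_closure (C : MLFClosure.{u}) :
    IsQMonoprime (Associates (nonzeroIntegers C.k C.K)) := by
  haveI : Algebra.IsAlgebraic C.k C.K := IsAlgClosure.isAlgebraic
  haveI : IsAlgClosed C.K := IsAlgClosure.isAlgClosed C.k
  exact isQMonoprime_associates_nonzeroIntegers C.k C.K

/-- `𝒪^▷_k̄/𝒪_k̄^×` is monoprime, for the model data `C = (k, k̄)`. [cite: Mochizuki2012, Prop 4.1 (ii) p.121] -/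
theorem isMonoprime_associates_nonzeroIntegers_closure (C : MLFClosure.{u}) :
    IsMonoprime (Associates (nonzeroIntegers C.k C.K)) :=
  IsMonoprime.ofQ (isQMonoprime_associates_nonzeroIntegers_closure C)

/-- **Every MLF-Galois `TM`-pair `Q = (Π ↷ M)` ([AbsTopIII] Def 3.1 (ii)) has `M/M^× ≅ ℚ_{≥0}`, in particular
monoprime** — transport along the model isomorphism `𝒪^▷_k̄ ⥲ M`. This discharges the hypothesis
`h : IsMonoprime (Associates P.M)` of `GoodPrimeKummerBridgeSemiSimplified` / `ThetaMonoidsKummerLabeledUnits` /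
`PsiRlf.existsUnique_iso` for every such pair. [cite: Mochizuki2012, Prop 4.1 (ii) p.121] -/
theorem isQMonoprime_associates_of_isMLFGaloisMonoidPair {Q : GaloisMonoidPair.{u}}
    (hQ : IsMLFGaloisMonoidPair .TM Q) : IsQMonoprime (Associates Q.M) := by
  obtain ⟨C, D, Q₀, hD, ⟨e⟩⟩ := hQ.exists_model
  have hQ₀ : Q₀ = _ := (Option.some.inj hD).symm
  subst hQ₀
  exact (isQMonoprime_associates_nonzeroIntegers_closure C).of_mulEquiv (GoodPrimeKummer.assocCongr e.isoM)

/-- Monoprime form of `isQMonoprime_associates_of_isMLFGaloisMonoidPair`. [cite: Mochizuki2012, Prop 4.1 (ii) p.121] -/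
theorem isMonoprime_associates_of_isMLFGaloisMonoidPair {Q : GaloisMonoidPair.{u}}
    (hQ : IsMLFGaloisMonoidPair .TM Q) : IsMonoprime (Associates Q.M) :=
  IsMonoprime.ofQ (isQMonoprime_associates_of_isMLFGaloisMonoidPair hQ)

/-- Every `TM`-pair **of mono-analytic type** (the `Ψ_cns(G_v)` of [IUTchII] Prop 4.1 (i)/(ii), Prop 4.2 (i)/(ii))
has `M/M^×` monoprime. [cite: Mochizuki2012, Prop 4.1 (ii) p.121] -/
theorem isMonoprime_associates_of_isOfMonoAnalyticTypeMonoid {Q : GaloisMonoidPair.{u}}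
    (hQ : IsOfMonoAnalyticTypeMonoid .TM Q) : IsMonoprime (Associates Q.M) := by
  obtain ⟨C, D, Q₀, -, hD, ⟨e⟩⟩ := hQ.exists_model
  have hQ₀ : Q₀ = _ := (Option.some.inj hD).symm
  subst hQ₀
  exact (isMonoprime_associates_nonzeroIntegers_closure C).of_mulEquiv (GoodPrimeKummer.assocCongr e.isoM)

/-- `𝒪^▷_k̄` has non-units (e.g. the image of a uniformiser of `k`), for the model data `C = (k, k̄)`.
[cite: Mochizuki2012, Prop 4.1 (ii) p.121] -/
theorem exists_not_isUnit_nonzeroIntegers (C : MLFClosure.{u}) : ∃ p : nonzeroIntegers C.k C.K, ¬ IsUnit p := by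
  haveI : Algebra.IsAlgebraic C.k C.K := IsAlgClosure.isAlgebraic
  obtain ⟨ϖ, hϖ⟩ := IsDiscreteValuationRing.exists_irreducible 𝒪[C.k]
  exact ⟨_, not_isUnit_algebraMap_uniformizer C.k C.K hϖ⟩

/-- **[IUTchII] Prop 4.1 (ii), the natural isomorphism `Ψ^R_cns(G_v) ⥲ R_{≥0}(G_v)` AT THE GENUINE CONSTANT MONOID,
UNCONDITIONALLY**: for the model data `C = (k, k̄)`, any non-unit `p ∈ 𝒪^▷_k̄` (e.g. `p_v`) and any `R_{≥0}(G_v)`-datum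
`D ∋ log(p_v) > 0`, there is a UNIQUE isomorphism of monoids `(𝒪^▷_k̄/𝒪_k̄^×)^rlf ⥲ ℝ_{≥0}` carrying the class of `p` to
`log(p_v)` — abc-iut-L6-t2's `PsiRlf.existsUnique_iso` with its monoprimality hypothesis supplied by
`isMonoprime_associates_nonzeroIntegers_closure`. [cite: Mochizuki2012, Prop 4.1 (ii) p.121] -/
theorem existsUnique_realifiedIso_nonzeroIntegers (C : MLFClosure.{u}) {p : nonzeroIntegers C.k C.K}
    (hp : ¬ IsUnit p) (D : LogRealDatum) :
    ∃! e : PsiRlf (nonzeroIntegers C.k C.K) ≃* Multiplicative ℝ≥0,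
      e (PsiRlf.logp p) = Multiplicative.ofAdd D.logp :=
  PsiRlf.existsUnique_iso (isMonoprime_associates_nonzeroIntegers_closure C) hp D

/-- **[IUTchII] Prop 4.1 (ii) at the genuine constant monoid with the printed distinguished element `p_v`**: for the
model data `C = (k, k̄)` and any `R_{≥0}(G_v)`-datum `D ∋ log(p_v) > 0` there is a UNIQUE isomorphism of monoids
`(𝒪^▷_k̄/𝒪_k̄^×)^rlf ⥲ ℝ_{≥0}` carrying the class of the residue characteristic `p_v ∈ 𝒪^▷_k̄` to `log(p_v)`.
[cite: Mochizuki2012, Prop 4.1 (ii) p.121] -/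
theorem existsUnique_realifiedIso_nonzeroIntegers_ringChar (C : MLFClosure.{u}) (D : LogRealDatum) :
    haveI : Algebra.IsAlgebraic C.k C.K := IsAlgClosure.isAlgebraic
    ∃! e : PsiRlf (nonzeroIntegers C.k C.K) ≃* Multiplicative ℝ≥0,
      e (PsiRlf.logp ⟨((ringChar 𝓀[C.k] : ℕ) : C.K),
        natCast_ringChar_residueField_mem_nonzeroIntegers C.k C.K⟩) = Multiplicative.ofAdd D.logp := by
  haveI : Algebra.IsAlgebraic C.k C.K := IsAlgClosure.isAlgebraic
  exact existsUnique_realifiedIso_nonzeroIntegers C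
    (not_isUnit_natCast_ringChar_residueField C.k C.K _) D

end Model

/-! ## Addendum (v2, same seat): the natural isomorphism IS the normalised valuation; `h`-free torsor statements

Appended (append-only v2; the module `Literature.IUT.LogThetaLattice.ThetaMonoidsKummerLabeledUnitsGenuine` planned for this
content could not be elaborated while this module's olean was unbuilt on the farm, so the theorems live here, in this file's
namespace). Sources: [IUTchII] Prop 4.1 (ii) p. 121 / Prop 4.2 (ii) p. 124 (kurims Dec-2020, `paper:url-5036b4059555`);
[IUTchIII] Prop 2.1 (iv) p. 60 (`paper:url-4b091feeb646`).
* `toAdd_toNNReal_logp_eq` (+ `_ringChar`) — **THE EXPLICIT FORMULA**: at `Ψ = 𝒪^▷_k̄` (`K` algebraically closed) abc-iut-L6-t2's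
  normalised isomorphism `PsiRlf.toNNReal : (Ψ/Ψ^×)^rlf ⥲ ℝ_{≥0}` (the natural isomorphism `Ψ^R_cns(G_v) ⥲ R_{≥0}(G_v)`,
  `[p] ↦ log(p_v)`) sends the class of `x` to `log(p_v) · log|x|_sp / log|p|_sp` — the normalised valuation `ord_{p_v}(x) · log(p_v)`,
  i.e. `-log|x|` in the normalisation `|p_v| = p_v⁻¹`: the Kummer/Frobenioid-side realified degree IS the (negative) log-volume
  weight of [IUTchIII] §3 (`x^{n m'} ~ᵤ p^{n' m}` for `|x|^n = ‖ϖ‖^m`, `|p|^{n'} = ‖ϖ‖^{m'}`, then compare exponents);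
* `prop42ii_semiSimplifiedPolyIso_torsor_of_monoAnalytic`, `prop42ii_mem_semiSimplifiedPolyIso_iff_of_monoAnalytic` — [IUTchII]
  Prop 4.2 (ii)'s Kummer poly-isomorphism of semi-simplifications is exactly one `Ẑ^×`-torsor for `TM`-pairs of mono-analytic type
  with NO monoprimality hypothesis (`existsUnique_mem_semiSimplifiedPolyIsoNonarch` with `h` supplied by
  `isMonoprime_associates_of_isOfMonoAnalyticTypeMonoid`);
* `prop21iv_semiSimplifiedPolyIso_torsor_of_monoAnalytic`, `prop21iv_autOrbit_eq_semiSimplifiedPolyIso_of_monoAnalytic` — the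
  labelled versions of [IUTchIII] Prop 2.1 (iv) (`ThetaMonoidsKummerLabeledUnits`) with `h` discharged;
* non-vacuity at `k = ℚ_p` (abc-iut-L4-t2's `MLFClosure.ofPadic`).
-/

open Literature.IUT.HodgeArakelov.GoodPrimeKummer Literature.IUT.LogThetaLattice

universe w

/-! ### The natural isomorphism of [IUTchII] Prop 4.1 (ii) IS the normalised valuation: an explicit formula -/

section Formula

variable (k : Type u) [Field k] [ValuativeRel k] [TopologicalSpace k] [IsNonarchimedeanLocalField k]
  (K : Type u) [Field K] [Algebra k K] [Algebra.IsAlgebraic k K]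

/-- `ℕ`-exponent form of `exists_spectralNorm_pow_eq_norm_uniformizer_zpow` for elements of `𝒪^▷_k̄` (their
absolute value is `≤ 1`, so the exponent of `‖ϖ‖ < 1` is non-negative): `|x|_sp ^ n = ‖ϖ‖ ^ m`, `n ≥ 1`, `m ∈ ℕ`.
Ref: Neukirch, *ANT*, Ch. II (4.8). [cite: NeukirchANT1999, Ch. II (4.8)] -/
theorem exists_spectralNorm_pow_eq_norm_uniformizer_npow {ϖ : 𝒪[k]} (hϖ : Irreducible ϖ)
    (x : nonzeroIntegers k K) :
    letI := IsNonarchimedeanLocalField.nontriviallyNormedField k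
    ∃ n : ℕ, 0 < n ∧ ∃ m : ℕ, spectralNorm k K (x : K) ^ n = ‖(ϖ : k)‖ ^ m := by
  letI := IsNonarchimedeanLocalField.nontriviallyNormedField k
  obtain ⟨n, hn, m, h⟩ :=
    exists_spectralNorm_pow_eq_norm_uniformizer_zpow k K hϖ (coe_nonzeroIntegers_ne_zero k K x)
  have ha0 : 0 < ‖(ϖ : k)‖ := norm_uniformizer_pos k hϖ
  have ha1 : ‖(ϖ : k)‖ < 1 := norm_uniformizer_lt_one k hϖ
  have hm : 0 ≤ m := by
    by_contra hneg
    have hneg' : m < 0 := lt_of_not_ge hneg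
    have h1 : (1 : ℝ) < ‖(ϖ : k)‖⁻¹ ^ (-m) := one_lt_zpow₀ ((one_lt_inv₀ ha0).mpr ha1) (by omega)
    rw [inv_zpow', neg_neg, ← h] at h1
    exact (pow_le_one₀ (spectralNorm_nonneg _) (spectralNorm_coe_nonzeroIntegers_le_one k K x)).not_gt h1
  lift m to ℕ using hm
  exact ⟨n, hn, m, by rw [h, zpow_natCast]⟩

/-- **The natural isomorphism `Ψ^R_cns(G_v) ⥲ R_{≥0}(G_v)` of [IUTchII] Prop 4.1 (ii) IS the normalised valuation**
(`K` algebraically closed): abc-iut-L6-t2's normalised isomorphism `PsiRlf.toNNReal` (THE unique `(Ψ/Ψ^×)^rlf ⥲ ℝ_{≥0}`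
carrying the class of the non-unit `p` to `log(p_v)`), at the genuine constant monoid `Ψ = 𝒪^▷_k̄`, sends the class
of `x ∈ 𝒪^▷_k̄` to `log(p_v) · log|x|_sp / log|p|_sp` — for `p = p_v` and `log(p_v)` the real logarithm this is
`ord_{p_v}(x) · log(p_v) = -log|x|` in the normalisation `|p_v| = p_v⁻¹`, i.e. the (negative) LOG-VOLUME weight of
[IUTchIII] Prop 3.9 / Rmk 3.9.x read on the Kummer/Frobenioid side. (Proof: `x^{n m'} ~ᵤ p^{n' m}` where
`|x|^n = ‖ϖ‖^m`, `|p|^{n'} = ‖ϖ‖^{m'}`; apply the isomorphism and compare exponents.)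
[cite: Mochizuki2012, Prop 4.1 (ii) p.121] -/
theorem toAdd_toNNReal_logp_eq [IsAlgClosed K] {p : nonzeroIntegers k K} (hp : ¬ IsUnit p) (D : LogRealDatum)
    (x : nonzeroIntegers k K) :
    letI := IsNonarchimedeanLocalField.nontriviallyNormedField k
    ((Multiplicative.toAdd (PsiRlf.toNNReal (isMonoprime_associates_nonzeroIntegers k K) hp D
        (PsiRlf.logp x)) : ℝ≥0) : ℝ) =
      D.logp * (Real.log (spectralNorm k K (x : K)) / Real.log (spectralNorm k K (p : K))) := by
  letI := IsNonarchimedeanLocalField.nontriviallyNormedField k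
  obtain ⟨ϖ, hϖ⟩ := IsDiscreteValuationRing.exists_irreducible 𝒪[k]
  have ha0 : 0 < ‖(ϖ : k)‖ := norm_uniformizer_pos k hϖ
  have ha1 : ‖(ϖ : k)‖ < 1 := norm_uniformizer_lt_one k hϖ
  have hL0 : Real.log ‖(ϖ : k)‖ ≠ 0 := (Real.log_neg ha0 ha1).ne
  obtain ⟨n, hn, m, hx⟩ := exists_spectralNorm_pow_eq_norm_uniformizer_npow k K hϖ x
  obtain ⟨n', hn', m', hp'⟩ := exists_spectralNorm_pow_eq_norm_uniformizer_npow k K hϖ p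
  have hxpos : 0 < spectralNorm k K (x : K) := spectralNorm_coe_nonzeroIntegers_pos k K x
  have hppos : 0 < spectralNorm k K (p : K) := spectralNorm_coe_nonzeroIntegers_pos k K p
  -- `p` is a non-unit: `|p| < 1`, so `m' ≠ 0` and `log|p| ≠ 0`
  have hp1 : spectralNorm k K (p : K) < 1 :=
    lt_of_le_of_ne (spectralNorm_coe_nonzeroIntegers_le_one k K p)
      (fun h => hp ((nonzeroIntegers_isUnit_iff_spectralNorm_eq_one k K p).mpr h))
  have hm' : m' ≠ 0 := by
    rintro rfl
    rw [pow_zero] at hp'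
    exact (pow_lt_one₀ (spectralNorm_nonneg _) hp1 hn'.ne').ne hp'
  have hlogp0 : Real.log (spectralNorm k K (p : K)) ≠ 0 := (Real.log_neg hppos hp1).ne
  -- logarithmic exponent identities
  have hlx : (n : ℝ) * Real.log (spectralNorm k K (x : K)) = (m : ℝ) * Real.log ‖(ϖ : k)‖ := by
    rw [← Real.log_pow, ← Real.log_pow, hx]
  have hlp : (n' : ℝ) * Real.log (spectralNorm k K (p : K)) = (m' : ℝ) * Real.log ‖(ϖ : k)‖ := by
    rw [← Real.log_pow, ← Real.log_pow, hp']
  -- `x ^ (n m')` and `p ^ (n' m)` have the same absolute value, hence are associated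
  have hassoc : Associated (x ^ (n * m')) (p ^ (n' * m)) := by
    rw [nonzeroIntegers_associated_iff_spectralNorm_eq, SubmonoidClass.coe_pow, SubmonoidClass.coe_pow,
      spectralNorm_pow_eq, spectralNorm_pow_eq, pow_mul, hx, pow_mul, hp', ← pow_mul, ← pow_mul, mul_comm]
  -- apply the normalised isomorphism `e`
  set e := PsiRlf.toNNReal (isMonoprime_associates_nonzeroIntegers k K) hp D with he_def
  have he : e (PsiRlf.logp p) = Multiplicative.ofAdd D.logp :=
    PsiRlf.toNNReal_logp (isMonoprime_associates_nonzeroIntegers k K) hp D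
  have hlogp_pow : PsiRlf.logp x ^ (n * m') = PsiRlf.logp p ^ (n' * m) := by
    change Realification.of _ (Associates.mk (x : nonzeroIntegers k K)) ^ (n * m') =
      Realification.of _ (Associates.mk (p : nonzeroIntegers k K)) ^ (n' * m)
    rw [← map_pow, ← map_pow, ← Associates.mk_pow, ← Associates.mk_pow,
      Associates.mk_eq_mk_iff_associated.mpr hassoc]
  have hexp : (n * m') • Multiplicative.toAdd (e (PsiRlf.logp x)) = (n' * m) • D.logp := by
    rw [← toAdd_pow, ← map_pow, hlogp_pow, map_pow, he, toAdd_pow, toAdd_ofAdd]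
  -- compare in `ℝ`
  have hexpR : ((n : ℝ) * m') * ((Multiplicative.toAdd (e (PsiRlf.logp x)) : ℝ≥0) : ℝ) =
      ((n' : ℝ) * m) * D.logp := by
    have := congrArg (fun z : ℝ≥0 => (z : ℝ)) hexp
    simpa [nsmul_eq_mul, Nat.cast_mul, mul_assoc] using this
  have hnR : (n : ℝ) ≠ 0 := Nat.cast_ne_zero.mpr hn.ne'
  have hn'R : (n' : ℝ) ≠ 0 := Nat.cast_ne_zero.mpr hn'.ne'
  have hm'R : (m' : ℝ) ≠ 0 := Nat.cast_ne_zero.mpr hm'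
  -- solve for the value
  have hval : ((Multiplicative.toAdd (e (PsiRlf.logp x)) : ℝ≥0) : ℝ) = ((n' : ℝ) * m) * D.logp / ((n : ℝ) * m') := by
    rw [eq_div_iff (mul_ne_zero hnR hm'R), mul_comm, hexpR]
  rw [hval]
  -- and compare with the log ratio: `log|x|/log|p| = (m/n)/(m'/n') = (n' m)/(n m')`
  have hratio : Real.log (spectralNorm k K (x : K)) / Real.log (spectralNorm k K (p : K)) =
      ((n' : ℝ) * m) / ((n : ℝ) * m') := by
    rw [div_eq_div_iff hlogp0 (mul_ne_zero hnR hm'R)]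
    calc Real.log (spectralNorm k K (x : K)) * ((n : ℝ) * m')
        = ((n : ℝ) * Real.log (spectralNorm k K (x : K))) * m' := by ring
      _ = ((m : ℝ) * Real.log ‖(ϖ : k)‖) * m' := by rw [hlx]
      _ = (m : ℝ) * ((m' : ℝ) * Real.log ‖(ϖ : k)‖) := by ring
      _ = (m : ℝ) * ((n' : ℝ) * Real.log (spectralNorm k K (p : K))) := by rw [hlp]
      _ = ((n' : ℝ) * m) * Real.log (spectralNorm k K (p : K)) := by ring
  rw [hratio]
  ring

/-- `MLFClosure` form of `toAdd_toNNReal_logp_eq` with the printed distinguished element `p_v` (the residue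
characteristic): the natural isomorphism of [IUTchII] Prop 4.1 (ii) at `𝒪^▷_k̄` sends the class of `x` to
`log(p_v) · log|x|_sp / log|p_v|_sp`. [cite: Mochizuki2012, Prop 4.1 (ii) p.121] -/
theorem toAdd_toNNReal_logp_eq_ringChar (C : MLFClosure.{u}) (D : LogRealDatum)
    (x : nonzeroIntegers C.k C.K) :
    haveI : Algebra.IsAlgebraic C.k C.K := IsAlgClosure.isAlgebraic
    letI := IsNonarchimedeanLocalField.nontriviallyNormedField C.k
    ((Multiplicative.toAdd (PsiRlf.toNNReal (isMonoprime_associates_nonzeroIntegers_closure C)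
        (not_isUnit_natCast_ringChar_residueField C.k C.K
          (natCast_ringChar_residueField_mem_nonzeroIntegers C.k C.K)) D (PsiRlf.logp x)) : ℝ≥0) : ℝ) =
      D.logp * (Real.log (spectralNorm C.k C.K (x : C.K)) /
        Real.log (spectralNorm C.k C.K ((ringChar 𝓀[C.k] : ℕ) : C.K))) := by
  haveI : Algebra.IsAlgebraic C.k C.K := IsAlgClosure.isAlgebraic
  haveI : IsAlgClosed C.K := IsAlgClosure.isAlgClosed C.k
  exact toAdd_toNNReal_logp_eq C.k C.K _ D x

end Formula

/-! ### [IUTchII] Prop 4.2 (ii): one pair -/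

section OnePair

variable (P Q : GaloisMonoidPair.{0}) (f : P.Pi ≃ₜ* Q.Pi)

/-- **[IUTchII] Prop 4.2 (ii), the Kummer poly-isomorphism of semi-simplifications is EXACTLY ONE `Ẑ^×`-torsor — for
`TM`-pairs of mono-analytic type, with NO monoprimality hypothesis**: for `P = (†G_v ↷ Ψ_{†F^⊢_v})`,
`Q = (†G_v ↷ Ψ_cns(†G_v))` of mono-analytic type, a non-unit `p ∈ Ψ_{†F^⊢_v}`, `R_{≥0}(†G_v) ∋ log(p_v)` and a cyclotome
datum `u`, there is exactly one member of `semiSimplifiedPolyIsoNonarch P Q f D` whose unit component induces `u`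
(abc-iut-L6-t5's `existsUnique_mem_semiSimplifiedPolyIsoNonarch`, its hypothesis `IsMonoprime (Associates Ψ)` supplied
by `isMonoprime_associates_of_isOfMonoAnalyticTypeMonoid`, its unit-pair hypotheses by
`isOfMonoAnalyticTypeMonoid_TCG_unitsPair`). [cite: Mochizuki2012, Prop 4.2 (ii) p.124] -/
theorem prop42ii_semiSimplifiedPolyIso_torsor_of_monoAnalytic (hP : IsOfMonoAnalyticTypeMonoid .TM P)
    (hQ : IsOfMonoAnalyticTypeMonoid .TM Q) {p : P.M} (hp : ¬ IsUnit p) (D : LogRealDatum)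
    (u : cyclotome P.unitsPair.M ≃* cyclotome Q.unitsPair.M) :
    ∃! e : SemiSimplifiedRlf P.M ≃* Q.Mˣ × Multiplicative ℝ≥0,
      ∃ φ : P.Mˣ ≃* Q.Mˣ, φ ∈ equivariantIsoOver P.unitsPair Q.unitsPair f ∧
        (∀ ζ, cyclotomeMapOf (P := P.unitsPair) (Q := Q.unitsPair) φ ζ = u ζ) ∧
        e = semiSimplifiedIsoNonarch P Q (isMonoprime_associates_of_isOfMonoAnalyticTypeMonoid hP) hp D φ :=
  existsUnique_mem_semiSimplifiedPolyIsoNonarch P Q f (isMonoprime_associates_of_isOfMonoAnalyticTypeMonoid hP) hp D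
    (isOfMonoAnalyticTypeMonoid_TCG_unitsPair hP) (isOfMonoAnalyticTypeMonoid_TCG_unitsPair hQ) u

/-- … and every member of the poly-isomorphism is `φ × ρ₀` with `ρ₀` THE normalised realified isomorphism, the
realified normalisation now resting on the PROVED monoprimality (`mem_semiSimplifiedPolyIsoNonarch_iff` with `h`
discharged). [cite: Mochizuki2012, Prop 4.2 (ii) p.124] -/
theorem prop42ii_mem_semiSimplifiedPolyIso_iff_of_monoAnalytic (hP : IsOfMonoAnalyticTypeMonoid .TM P)
    {p : P.M} (hp : ¬ IsUnit p) (D : LogRealDatum) (e : SemiSimplifiedRlf P.M ≃* Q.Mˣ × Multiplicative ℝ≥0) :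
    e ∈ semiSimplifiedPolyIsoNonarch P Q f (p := p) D ↔
      ∃ φ : P.Mˣ ≃* Q.Mˣ, φ ∈ equivariantIsoOver P.unitsPair Q.unitsPair f ∧
        e = semiSimplifiedIsoNonarch P Q (isMonoprime_associates_of_isOfMonoAnalyticTypeMonoid hP) hp D φ :=
  mem_semiSimplifiedPolyIsoNonarch_iff P Q f (isMonoprime_associates_of_isOfMonoAnalyticTypeMonoid hP) hp D e

end OnePair

/-! ### [IUTchIII] Prop 2.1 (iv): labelled families -/

section Labelled

variable {Lab : Type w} (P Q : Lab → GaloisMonoidPair.{0}) (f : ∀ t, (P t).Pi ≃ₜ* (Q t).Pi)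

/-- **[IUTchIII] Prop 2.1 (iv), label by label the labelled Kummer poly-isomorphism of semi-simplifications is
EXACTLY ONE `Ẑ^×`-torsor — with NO monoprimality hypothesis** (`prop21iv_semiSimplifiedPolyIso_torsor` with
`h : IsMonoprime (Associates (P t).M)` discharged by `isMonoprime_associates_of_isOfMonoAnalyticTypeMonoid (hP t)`).
[cite: Mochizuki2012, III Prop 2.1 (iv) p.60] -/
theorem prop21iv_semiSimplifiedPolyIso_torsor_of_monoAnalytic (hP : ∀ t, IsOfMonoAnalyticTypeMonoid .TM (P t))
    (hQ : ∀ t, IsOfMonoAnalyticTypeMonoid .TM (Q t)) (t : Lab) {p : (P t).M} (hp : ¬ IsUnit p) (D : LogRealDatum)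
    (uζ : cyclotome (P t).unitsPair.M ≃* cyclotome (Q t).unitsPair.M) :
    ∃! e : SemiSimplifiedRlf (P t).M ≃* (Q t).Mˣ × Multiplicative ℝ≥0,
      ∃ φ : (P t).Mˣ ≃* (Q t).Mˣ, φ ∈ equivariantIsoOver (P t).unitsPair (Q t).unitsPair (f t) ∧
        (∀ ζ, cyclotomeMapOf (P := (P t).unitsPair) (Q := (Q t).unitsPair) φ ζ = uζ ζ) ∧
        e = semiSimplifiedIsoNonarch (P t) (Q t)
          (isMonoprime_associates_of_isOfMonoAnalyticTypeMonoid (hP t)) hp D φ :=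
  prop21iv_semiSimplifiedPolyIso_torsor P Q f hP hQ t
    (isMonoprime_associates_of_isOfMonoAnalyticTypeMonoid (hP t)) hp D uζ

/-- **[IUTchIII] Prop 2.1 (iv) "In particular"** — the `Aut`-orbit of the member `φ^× × ρ₀` IS the Kummer
poly-isomorphism of semi-simplifications, for labelled `TM`-pairs of mono-analytic type, with NO monoprimality
hypothesis (`prop21iv_autOrbit_eq_semiSimplifiedPolyIso` with `h` discharged). [cite: Mochizuki2012, III Prop 2.1 (iv) p.60] -/
theorem prop21iv_autOrbit_eq_semiSimplifiedPolyIso_of_monoAnalytic (hP : ∀ t, IsOfMonoAnalyticTypeMonoid .TM (P t))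
    (t : Lab) (κ : (P t).M ≃* (Q t).M) (hκ : κ ∈ equivariantIsoOver (P t) (Q t) (f t)) {p : (P t).M}
    (hp : ¬ IsUnit p) (D : LogRealDatum) :
    {e | ∃ α : (P t).Mˣ ≃* (P t).Mˣ,
        α ∈ equivariantIsoOver (P t).unitsPair (P t).unitsPair (ContinuousMulEquiv.refl _) ∧
          e = (MulEquiv.prodCongr α (MulEquiv.refl (PsiRlf (P t).M))).trans
            (semiSimplifiedIsoNonarch (P t) (Q t)
              (isMonoprime_associates_of_isOfMonoAnalyticTypeMonoid (hP t)) hp D (Units.mapEquiv κ))} =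
      semiSimplifiedPolyIsoNonarch (P t) (Q t) (f t) (p := p) D :=
  prop21iv_autOrbit_eq_semiSimplifiedPolyIso P Q f t κ hκ
    (isMonoprime_associates_of_isOfMonoAnalyticTypeMonoid (hP t)) hp D

end Labelled

/-! ### Non-vacuity at `k = ℚ_p` -/

section Padic

variable (p : ℕ) [Fact p.Prime]

/-- **Non-vacuity of the genuine bracket of [IUTchII] Prop 4.1 (ii) at `k = ℚ_p`**: the divisor monoid
`𝒪^▷_{ℚ̄_p}/𝒪^×_{ℚ̄_p}` of abc-iut-L4-t2's concrete model `MLFClosure.ofPadic p` IS isomorphic to `ℚ_{≥0}`.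
[cite: Mochizuki2012, Prop 4.1 (ii) p.121] -/
theorem isQMonoprime_associates_nonzeroIntegers_ofPadic :
    IsQMonoprime (Associates (nonzeroIntegers (MLFClosure.ofPadic p).k (MLFClosure.ofPadic p).K)) :=
  isQMonoprime_associates_nonzeroIntegers_closure (MLFClosure.ofPadic p)

/-- … and there the natural isomorphism `Ψ^R_cns(G_v) ⥲ R_{≥0}(G_v)` normalised at the residue characteristic `p_v = p`
exists uniquely, for every `R_{≥0}`-datum. [cite: Mochizuki2012, Prop 4.1 (ii) p.121] -/
theorem existsUnique_realifiedIso_nonzeroIntegers_ofPadic (D : LogRealDatum) :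
    haveI : Algebra.IsAlgebraic (MLFClosure.ofPadic p).k (MLFClosure.ofPadic p).K := IsAlgClosure.isAlgebraic
    ∃! e : PsiRlf (nonzeroIntegers (MLFClosure.ofPadic p).k (MLFClosure.ofPadic p).K) ≃* Multiplicative ℝ≥0,
      e (PsiRlf.logp ⟨((ringChar 𝓀[(MLFClosure.ofPadic p).k] : ℕ) : (MLFClosure.ofPadic p).K),
        natCast_ringChar_residueField_mem_nonzeroIntegers _ _⟩) = Multiplicative.ofAdd D.logp :=
  existsUnique_realifiedIso_nonzeroIntegers_ringChar (MLFClosure.ofPadic p) D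

end Padic

end Literature.IUT.HodgeArakelov

end
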